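import Summits.CriticalPhenomena.SAWScalingLimit.Theorems.SAWTotalPositivityTPToTraversalBoundDiveDefs
import Summits.CriticalPhenomena.SAWScalingLimit.Theorems.SAWLeftRightFKGFKGToTraversalBoundDomainMarkov

/-!
# Prefix determination, uniqueness and re-basing of canonical traversal times; stopped prefix families —
worker helper file for the stub `multiDiveBound_of_unforcedDiveBound` (line `exit-mass-unforced-dive`,
crux `SAWTotalPositivity.TPToTraversalBound`, stmt-CriticalPhenomena-10687)

Vocabulary (landed, `…TPToTraversalBoundDiveDefs.lean`): `IsTraversal δ z₀ r R w i j` (the index segment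
`[i, j]` of the lattice walk `w` traverses the annulus `A(z₀, r, R)`), `TravSeq δ z₀ r R q n E` (the
canonical = greedy sequence `E 0 = 0 < E 1 < ⋯ < E n` of completion times of the first `n` traversals of
the clock annulus by `q`), `Targets`, `PrefixSet`.  This file is the CLOCK-INDEPENDENT bookkeeping behind
nested optional stopping (Kemppainen–Smirnov, proof of Prop. 3.5, "Condition G2 ⇒ Condition G3"), all
elementary and valid for every `Ω ⊆ ℂ` and every mesh:

* traversals only read `getVert` up to the completion index (`isTraversal_congr`), hence PREFIX
  DETERMINATION `isTraversal_take_iff` (traversals of `q.take t` = traversals of `q` completed by time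
  `t`), RE-BASING `isTraversal_drop_iff` (traversals of `q.drop t` = traversals of `q` after `t`, shifted
  by `t`), `isTraversal_copy_iff`, `isTraversal_append_left_iff`;
* canonical times: strict monotonicity and bounds (`TravSeq.lt_succ`, `.monotone`, `.le_length`,
  `.of_le`), UNIQUENESS (`TravSeq.unique`), PREFIX DETERMINATION (`travSeq_take_iff` — the registered
  helper stub of this file; `travSeq_append_iff`, `travSeq_copy_iff`, all from the transfer principle
  `travSeq_iff_of_isTraversal_iff`), RE-BASING at a canonical time (`TravSeq.drop`);
* `Targets … η b` depends on the prefix `η` only through `η.support` and its tip (`targets_congr`);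
* stopped prefix families: the prefixes `η ++ ρ` STOPPED at a clock level `m` (`E m = |ρ|`) have pairwise
  disjoint extension sets (`pairwiseDisjoint_prefixSet_stopped`: a common extension induces the same
  canonical times on both, so both have the same length), and the abstract optional-stopping inequality
  `μ S ≤ c · μ (⋃_{i ∈ F} B i)` for a cover `S ⊆ ⋃_{i ∈ F} A i` with `μ (A i) ≤ c · μ (B i)` and pairwise
  disjoint `B i` over a countable index type (`measure_le_mul_measure_biUnion`; walks of a graph on `ℤ²`
  form a countable type, `countable_walk`).

Small walk facts not found in Mathlib: `getVert_append_of_le`, `support_take_append_of_le`,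
`support_take_take_of_le`, `support_append_take_add` (left cancellation of `Walk.append` is the landed
`FKGToTraversalBound.ExcursionDomination.append_left_cancel` of `…FKGToTraversalBoundDomainMarkov.lean`).

Sources: A. Kemppainen, S. Smirnov, *Random curves, scaling limits and Loewner evolutions*, Ann. Probab.
45 (2017) 698–779 = arXiv:1212.6215, §2.2 and §3.2 (crossing times, nested stopping in "G2 ⇒ G3");
N. Madras, G. Slade, *The Self-Avoiding Walk* (1993), §1.2 (prefix bookkeeping for SAW weights).
No definitions: everything is a theorem.
-/

noncomputable section

open MeasureTheory Set
open scoped ENNReal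
open Literature.Probability.LatticeModels
open Literature.Probability.RandomPlanarGeometry
open Summit.CriticalPhenomena.SAWScalingLimit.Theorems.TPToTraversalBound.Negative (PrefixSet)

namespace Summit.CriticalPhenomena.SAWScalingLimit.Theorems.TPToTraversalBound.ExitMass

variable {Ω : Set ℂ} {δ : ℝ} {z₀ : ℂ} {r R : ℝ}

/-! ## Small facts about Mathlib walks -/

/-- Up to the length of `p`, the vertices of `p ++ q` are those of `p` (including the junction). [folklore] -/
theorem getVert_append_of_le {V : Type*} {G : SimpleGraph V} {u v w : V} (p : G.Walk u v)
    (q : G.Walk v w) {m : ℕ} (hm : m ≤ p.length) : (p.append q).getVert m = p.getVert m := by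
  rw [SimpleGraph.Walk.getVert_append]
  split_ifs with h
  · rfl
  · obtain rfl : m = p.length := le_antisymm hm (not_lt.1 h)
    simp

/-- The support of a prefix of `p ++ q` not longer than `p` is the support of the same prefix of `p`.
[folklore] -/
theorem support_take_append_of_le {V : Type*} {G : SimpleGraph V} {u v w : V} (p : G.Walk u v)
    (q : G.Walk v w) {t : ℕ} (ht : t ≤ p.length) :
    ((p.append q).take t).support = (p.take t).support := by
  rw [SimpleGraph.Walk.support_take, SimpleGraph.Walk.support_take, SimpleGraph.Walk.support_append,
    List.take_append_of_le_length (by rw [SimpleGraph.Walk.length_support]; omega)]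

/-- Nested prefixes: `(q.take t).take s` and `q.take s` have the same support for `s ≤ t`. [folklore] -/
theorem support_take_take_of_le {V : Type*} {G : SimpleGraph V} {u v : V} (q : G.Walk u v) {s t : ℕ}
    (hst : s ≤ t) : ((q.take t).take s).support = (q.take s).support := by
  rw [SimpleGraph.Walk.support_take, SimpleGraph.Walk.support_take, SimpleGraph.Walk.support_take,
    List.take_take, min_eq_left (by omega)]

/-- Splitting a prefix after a prefix: `η ++ q.take (t + s)` and `(η ++ q.take t) ++ (q.drop t).take s` have
the same support. [folklore] -/
theorem support_append_take_add {V : Type*} {G : SimpleGraph V} {a u v : V} (η : G.Walk a u)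
    (q : G.Walk u v) (t s : ℕ) : (η.append (q.take (t + s))).support =
      ((η.append (q.take t)).append ((q.drop t).take s)).support := by
  rw [SimpleGraph.Walk.take_add_eq, SimpleGraph.Walk.support_append, SimpleGraph.Walk.support_copy,
    ← SimpleGraph.Walk.support_append, SimpleGraph.Walk.append_assoc]

/-- Walks of a graph on a countable vertex type form a countable type (they inject into vertex lists).
[folklore] -/
theorem countable_walk {V : Type*} [Countable V] {G : SimpleGraph V} (u v : V) :
    Countable (G.Walk u v) :=
  Function.Injective.countable SimpleGraph.Walk.support_injective

/-! ## Traversals only read `getVert` up to the completion index -/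

/-- `IsTraversal … w i j` depends on `w` only through `j ≤ w.length` and the vertices `w 0, …, w j`.
[folklore] -/
theorem isTraversal_congr {u v u' v' : Site 2} {w : (discreteDomainGraph Ω δ).Walk u v}
    {w' : (discreteDomainGraph Ω δ).Walk u' v'} {i j : ℕ}
    (hlen : j ≤ w'.length ↔ j ≤ w.length) (hget : ∀ m ≤ j, w'.getVert m = w.getVert m) :
    IsTraversal δ z₀ r R w' i j ↔ IsTraversal δ z₀ r R w i j := by
  unfold IsTraversal
  constructor
  · rintro ⟨hij, hj, hends, hmid⟩
    refine ⟨hij, hlen.1 hj, ?_, fun l hil hlj => ?_⟩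
    · rwa [← hget i hij.le, ← hget j le_rfl]
    · rw [← hget l hlj.le]; exact hmid l hil hlj
  · rintro ⟨hij, hj, hends, hmid⟩
    refine ⟨hij, hlen.2 hj, ?_, fun l hil hlj => ?_⟩
    · rwa [hget i hij.le, hget j le_rfl]
    · rw [hget l hlj.le]; exact hmid l hil hlj

/-- Traversals are invariant under `Walk.copy`. [folklore] -/
theorem isTraversal_copy_iff {u v u' v' : Site 2} (w : (discreteDomainGraph Ω δ).Walk u v)
    (hu : u = u') (hv : v = v') (i j : ℕ) :
    IsTraversal δ z₀ r R (w.copy hu hv) i j ↔ IsTraversal δ z₀ r R w i j := by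
  subst hu hv; rfl

/-- **Re-basing of traversals**: the traversals of the future `q.drop t` are the traversals of `q` after
`t`, shifted by `t`. [folklore] -/
theorem isTraversal_drop_iff {u v : Site 2} (q : (discreteDomainGraph Ω δ).Walk u v) (t i j : ℕ) :
    IsTraversal δ z₀ r R (q.drop t) i j ↔ IsTraversal δ z₀ r R q (t + i) (t + j) := by
  simp only [IsTraversal, SimpleGraph.Walk.drop_getVert, SimpleGraph.Walk.drop_length]
  constructor
  · rintro ⟨hij, hj, hends, hmid⟩
    refine ⟨by omega, by omega, hends, fun l hil hlj => ?_⟩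
    obtain ⟨l, rfl⟩ : ∃ l₀, l = t + l₀ := ⟨l - t, by omega⟩
    exact hmid l (by omega) (by omega)
  · rintro ⟨hij, hj, hends, hmid⟩
    exact ⟨by omega, by omega, hends, fun l hil hlj => hmid (t + l) (by omega) (by omega)⟩

/-- **Prefix determination of traversals**: the traversals of the prefix `q.take t` are exactly the
traversals `[i, j]` of `q` completed by time `t`. [folklore] -/
theorem isTraversal_take_iff {u v : Site 2} (q : (discreteDomainGraph Ω δ).Walk u v) (t i j : ℕ) :
    IsTraversal δ z₀ r R (q.take t) i j ↔ IsTraversal δ z₀ r R q i j ∧ j ≤ t := by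
  have key : j ≤ t → (IsTraversal δ z₀ r R (q.take t) i j ↔ IsTraversal δ z₀ r R q i j) :=
    fun hjt => isTraversal_congr (by rw [SimpleGraph.Walk.take_length]; omega)
      fun m hm => by rw [SimpleGraph.Walk.take_getVert, inf_eq_right.2 (hm.trans hjt)]
  constructor
  · intro h
    have hjt : j ≤ t := by have := h.2.1; rw [SimpleGraph.Walk.take_length] at this; omega
    exact ⟨(key hjt).1 h, hjt⟩
  · rintro ⟨h, hjt⟩
    exact (key hjt).2 h

/-- Traversals of `p` are exactly the traversals of `p ++ q` completed within `p`. [folklore] -/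
theorem isTraversal_append_left_iff {u v w : Site 2} (p : (discreteDomainGraph Ω δ).Walk u v)
    (q : (discreteDomainGraph Ω δ).Walk v w) (i j : ℕ) :
    IsTraversal δ z₀ r R p i j ↔ IsTraversal δ z₀ r R (p.append q) i j ∧ j ≤ p.length := by
  have key : j ≤ p.length → (IsTraversal δ z₀ r R p i j ↔ IsTraversal δ z₀ r R (p.append q) i j) :=
    fun hj => isTraversal_congr (by rw [SimpleGraph.Walk.length_append]; omega)
      fun m hm => (getVert_append_of_le p q (hm.trans hj)).symm
  constructor
  · intro h
    exact ⟨(key h.2.1).1 h, h.2.1⟩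
  · rintro ⟨h, hj⟩
    exact (key hj).2 h

/-! ## Canonical traversal times `TravSeq` -/

section TravSeq

variable {u v : Site 2} {q : (discreteDomainGraph Ω δ).Walk u v} {n : ℕ} {E : ℕ → ℕ}

/-- Canonical times strictly increase: `E m < E (m + 1)` for `m < n`. [folklore] -/
theorem TravSeq.lt_succ (h : TravSeq δ z₀ r R q n E) {m : ℕ} (hm : m < n) : E m < E (m + 1) := by
  obtain ⟨i, hi, htr, -⟩ := h.2 m hm
  exact lt_of_le_of_lt hi htr.1

/-- Canonical times are monotone on `[0, n]`. [folklore] -/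
theorem TravSeq.monotone (h : TravSeq δ z₀ r R q n E) :
    ∀ {m m' : ℕ}, m ≤ m' → m' ≤ n → E m ≤ E m' := by
  intro m m' hmm'
  induction hmm' with
  | refl => exact fun _ => le_rfl
  | @step k _ ih => exact fun hk => (ih (by omega)).trans (h.lt_succ (by omega)).le

/-- Canonical times do not exceed the length of the walk. [folklore] -/
theorem TravSeq.le_length (h : TravSeq δ z₀ r R q n E) {m : ℕ} (hm : m ≤ n) : E m ≤ q.length := by
  rcases m with _ | m
  · rw [h.1]; exact Nat.zero_le _
  · obtain ⟨i, -, htr, -⟩ := h.2 m hm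
    exact htr.2.1

/-- Canonical times up to level `n` are canonical times up to every level `m ≤ n`. [folklore] -/
theorem TravSeq.of_le (h : TravSeq δ z₀ r R q n E) {m : ℕ} (hm : m ≤ n) : TravSeq δ z₀ r R q m E :=
  ⟨h.1, fun k hk => h.2 k (by omega)⟩

/-- **Uniqueness of canonical times**: two canonical sequences of the same walk agree on their common
levels. [folklore] -/
theorem TravSeq.unique {n' : ℕ} {E' : ℕ → ℕ} (h : TravSeq δ z₀ r R q n E)
    (h' : TravSeq δ z₀ r R q n' E') : ∀ {m : ℕ}, m ≤ n → m ≤ n' → E m = E' m := by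
  intro m
  induction m with
  | zero => intro _ _; rw [h.1, h'.1]
  | succ m ih =>
    intro hm hm'
    have he : E m = E' m := ih (by omega) (by omega)
    obtain ⟨i, hi, htr, hmin⟩ := h.2 m hm
    obtain ⟨i', hi', htr', hmin'⟩ := h'.2 m hm'
    exact le_antisymm (hmin i' _ (he.trans_le hi') htr') (hmin' i _ (he.symm.trans_le hi) htr)

/-- Transfer of canonical times along a "prefix relation" between two walks: if the traversals of `w'`
are exactly the traversals of `w` completed by time `t`, then canonical times of `w'` are the canonical
times of `w` whose last level is reached by time `t`. [folklore] -/
theorem travSeq_iff_of_isTraversal_iff {u' v' : Site 2} {w : (discreteDomainGraph Ω δ).Walk u v}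
    {w' : (discreteDomainGraph Ω δ).Walk u' v'} {t : ℕ}
    (hw : ∀ i j, IsTraversal δ z₀ r R w' i j ↔ IsTraversal δ z₀ r R w i j ∧ j ≤ t) (n : ℕ)
    (E : ℕ → ℕ) : TravSeq δ z₀ r R w' n E ↔ TravSeq δ z₀ r R w n E ∧ E n ≤ t := by
  constructor
  · intro h
    have hn : E n ≤ t := by
      rcases n with _ | m
      · rw [h.1]; exact Nat.zero_le _
      · obtain ⟨i, -, htr, -⟩ := h.2 m (Nat.lt_succ_self m)
        exact ((hw _ _).1 htr).2
    refine ⟨⟨h.1, fun m hm => ?_⟩, hn⟩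
    obtain ⟨i, hi, htr, hmin⟩ := h.2 m hm
    refine ⟨i, hi, ((hw _ _).1 htr).1, fun i' j' hi' htr' => ?_⟩
    by_cases hj' : j' ≤ t
    · exact hmin i' j' hi' ((hw _ _).2 ⟨htr', hj'⟩)
    · exact ((hw _ _).1 htr).2.trans (not_le.1 hj').le
  · rintro ⟨h, hn⟩
    refine ⟨h.1, fun m hm => ?_⟩
    obtain ⟨i, hi, htr, hmin⟩ := h.2 m hm
    exact ⟨i, hi, (hw _ _).2 ⟨htr, (h.monotone hm le_rfl).trans hn⟩,
      fun i' j' hi' htr' => hmin i' j' hi' ((hw _ _).1 htr').1⟩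

/-- **Prefix determination of canonical times** (the registered helper stub of this file): the canonical
times of the prefix `q.take t` up to level `n` are exactly the canonical times of `q` up to level `n`,
provided level `n` is reached by time `t` — `TravSeq (q.take t) n E ↔ TravSeq q n E ∧ E n ≤ t`.
[folklore] -/
theorem travSeq_take_iff : ∀ {Ω : Set ℂ} {δ : ℝ} {z₀ : ℂ} {r R : ℝ} {u v : Site 2}
    (q : (discreteDomainGraph Ω δ).Walk u v) (t n : ℕ) (E : ℕ → ℕ),
    TravSeq δ z₀ r R (q.take t) n E ↔ TravSeq δ z₀ r R q n E ∧ E n ≤ t :=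
  fun q t n E => travSeq_iff_of_isTraversal_iff (fun i j => isTraversal_take_iff q t i j) n E

/-- Canonical times of `p` are canonical times of every extension `p ++ q'` (and conversely when the last
level is reached within `p`). [folklore] -/
theorem travSeq_append_iff {w : Site 2} (p : (discreteDomainGraph Ω δ).Walk u v)
    (q' : (discreteDomainGraph Ω δ).Walk v w) (n : ℕ) (E : ℕ → ℕ) :
    TravSeq δ z₀ r R p n E ↔ TravSeq δ z₀ r R (p.append q') n E ∧ E n ≤ p.length :=
  travSeq_iff_of_isTraversal_iff (fun i j => isTraversal_append_left_iff p q' i j) n E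

/-- Canonical times are invariant under `Walk.copy`. [folklore] -/
theorem travSeq_copy_iff {u' v' : Site 2} (w : (discreteDomainGraph Ω δ).Walk u v) (hu : u = u')
    (hv : v = v') (n : ℕ) (E : ℕ → ℕ) :
    TravSeq δ z₀ r R (w.copy hu hv) n E ↔ TravSeq δ z₀ r R w n E := by
  subst hu hv; rfl

/-- **Re-basing of canonical times** at the canonical time of level `T ≤ n`: the future `q.drop (E T)`
has the canonical times `E (m + T) - E T`, `m ≤ n - T`. [folklore] -/
theorem TravSeq.drop (h : TravSeq δ z₀ r R q n E) {T : ℕ} (hT : T ≤ n) :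
    TravSeq δ z₀ r R (q.drop (E T)) (n - T) (fun m => E (m + T) - E T) := by
  refine ⟨by simp, fun m hm => ?_⟩
  show ∃ i, E (m + T) - E T ≤ i ∧ IsTraversal δ z₀ r R (q.drop (E T)) i (E (m + 1 + T) - E T) ∧
    ∀ i' j', E (m + T) - E T ≤ i' → IsTraversal δ z₀ r R (q.drop (E T)) i' j' →
      E (m + 1 + T) - E T ≤ j'
  rw [Nat.add_right_comm m 1 T]
  have hmT : m + T < n := by omega
  obtain ⟨i, hi, htr, hmin⟩ := h.2 (m + T) hmT
  have h1 : E T ≤ E (m + T) := h.monotone (by omega) hmT.le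
  have h2 : E (m + T) < E (m + T + 1) := h.lt_succ hmT
  refine ⟨i - E T, by omega, ?_, fun i' j' hi' htr' => ?_⟩
  · rw [isTraversal_drop_iff]
    have e1 : E T + (i - E T) = i := by omega
    have e2 : E T + (E (m + T + 1) - E T) = E (m + T + 1) := by omega
    rw [e1, e2]; exact htr
  · rw [isTraversal_drop_iff] at htr'
    have := hmin _ _ (by omega) htr'
    omega

end TravSeq

/-! ## `Targets` depends on the prefix only through its support and its tip -/

/-- `Targets … η b` only reads `η.support` and the tip of `η`. [folklore] -/
theorem targets_congr {a a' v v' : Site 2} (b : Site 2) (η : (discreteDomainGraph Ω δ).Walk a v)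
    (η' : (discreteDomainGraph Ω δ).Walk a' v') (hv : v = v') (h : η.support = η'.support) :
    Targets Ω δ z₀ r R η b = Targets Ω δ z₀ r R η' b := by
  subst hv
  unfold Targets
  rw [h]

/-! ## Stopped prefix families: disjointness and the optional-stopping inequality -/

/-- Chords extending an extension of `η` extend `η`. [folklore] -/
theorem prefixSet_append_subset {a v v' : Site 2} (b : Site 2) (η : (discreteDomainGraph Ω δ).Walk a v)
    (ρ : (discreteDomainGraph Ω δ).Walk v v') : PrefixSet Ω δ a b (η.append ρ) ⊆ PrefixSet Ω δ a b η :=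
  fun _ ⟨q, hq⟩ => ⟨ρ.append q, by rw [hq, SimpleGraph.Walk.append_assoc]⟩

/-- **Antichain property of a stopped family.**  The prefixes `η ++ ρ` STOPPED AT LEVEL `m` of the clock
annulus (the canonical time of level `m` of `ρ` is the end of `ρ`) have pairwise disjoint extension sets:
a chord extending two of them induces the same canonical times on both (prefix determination), so both
have the same length (uniqueness) and are the same prefix of the chord. [folklore] -/
theorem pairwiseDisjoint_prefixSet_stopped {a v : Site 2} (b : Site 2)
    (η : (discreteDomainGraph Ω δ).Walk a v) (m : ℕ) :
    {σ : Σ v', (discreteDomainGraph Ω δ).Walk a v' |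
        ∃ (v' : Site 2) (ρ : (discreteDomainGraph Ω δ).Walk v v'), σ = ⟨v', η.append ρ⟩ ∧
          ∃ E : ℕ → ℕ, TravSeq δ z₀ r R ρ m E ∧ E m = ρ.length}.PairwiseDisjoint
      fun σ => PrefixSet Ω δ a b σ.2 := by
  rintro σ₁ ⟨v₁, ρ₁, rfl, E₁, hE₁, hl₁⟩ σ₂ ⟨v₂, ρ₂, rfl, E₂, hE₂, hl₂⟩ hne
  refine Set.disjoint_left.2 fun γ ⟨q₁, hq₁⟩ ⟨q₂, hq₂⟩ => hne ?_
  dsimp only at q₁ q₂ hq₁ hq₂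
  rw [← SimpleGraph.Walk.append_assoc] at hq₁ hq₂
  have hQ : ρ₁.append q₁ = ρ₂.append q₂ :=
    FKGToTraversalBound.ExcursionDomination.append_left_cancel η (hq₁.symm.trans hq₂)
  have h1 : TravSeq δ z₀ r R (ρ₂.append q₂) m E₁ := by
    rw [← hQ]; exact ((travSeq_append_iff ρ₁ q₁ m E₁).1 hE₁).1
  have h2 : TravSeq δ z₀ r R (ρ₂.append q₂) m E₂ := ((travSeq_append_iff ρ₂ q₂ m E₂).1 hE₂).1
  have hlen : ρ₁.length = ρ₂.length := by
    rw [← hl₁, ← hl₂]; exact h1.unique h2 le_rfl le_rfl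
  have hv : v₁ = v₂ := by
    have e1 := getVert_append_of_le ρ₁ q₁ le_rfl
    have e2 := getVert_append_of_le ρ₂ q₂ le_rfl
    rw [SimpleGraph.Walk.getVert_length] at e1 e2
    exact e1.symm.trans (by rw [hQ, hlen]; exact e2)
  subst hv
  have hρ : ρ₁ = ρ₂ := by
    apply SimpleGraph.Walk.ext_support
    have hs := congrArg SimpleGraph.Walk.support hQ
    rw [SimpleGraph.Walk.support_append, SimpleGraph.Walk.support_append] at hs
    exact List.append_inj_left hs
      (by rw [SimpleGraph.Walk.length_support, SimpleGraph.Walk.length_support, hlen])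
  rw [hρ]

/-- **Optional-stopping inequality (abstract form).**  If `S` is covered by events `A i`, `i ∈ F`, each of
measure at most `c` times that of `B i`, and the `B i`, `i ∈ F`, are pairwise disjoint, then
`μ S ≤ c · μ (⋃_{i ∈ F} B i)` (countable index type; subadditivity, then additivity). [folklore] -/
theorem measure_le_mul_measure_biUnion {α ι : Type*} [MeasurableSpace α] [Countable ι] (μ : Measure α)
    {F : Set ι} {A B : ι → Set α} {c : ℝ≥0∞} {S : Set α} (hS : S ⊆ ⋃ i ∈ F, A i)
    (hA : ∀ i ∈ F, μ (A i) ≤ c * μ (B i)) (hdisj : F.PairwiseDisjoint B)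
    (hB : ∀ i ∈ F, MeasurableSet (B i)) : μ S ≤ c * μ (⋃ i ∈ F, B i) :=
  calc μ S ≤ μ (⋃ i ∈ F, A i) := measure_mono hS
    _ ≤ ∑' i : F, μ (A i) := measure_biUnion_le μ (Set.to_countable F) A
    _ ≤ ∑' i : F, c * μ (B i) := ENNReal.tsum_le_tsum fun i => hA i i.2
    _ = c * ∑' i : F, μ (B i) := ENNReal.tsum_mul_left
    _ = c * μ (⋃ i ∈ F, B i) := by rw [measure_biUnion (Set.to_countable F) hdisj hB]

end Summit.CriticalPhenomena.SAWScalingLimit.Theorems.TPToTraversalBound.ExitMass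

end
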